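import Mathlib
import HarnessLib
import Literature.Analysis.FluidPDE.TypeIAncientMild
import Summits.NavierStokesRegularity.NavierStokesRegularity.Theses.SymmetryModuliCount
import Summits.NavierStokesRegularity.NavierStokesRegularity.Theorems.SymmetryModuliCountFarPastLedger
import Summits.NavierStokesRegularity.NavierStokesRegularity.Theorems.SymmetryModuliCountForcedSymmetryCollapse
import Summits.NavierStokesRegularity.NavierStokesRegularity.Theorems.SymmetryModuliCountForcedSymmetryBlowDownResidual
import HarnessLib.Audit

/-!
# Line `LedgerHigherIntegrability` — FORWARD RUNG over the floor `FarPastLedger` (stmt-14060),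
# crux `SymmetryModuliCount.ForcedSymmetry` (stmt-NavierStokesRegularity-4052)

Forward generator G1 (`next-rung`), planner `planner-fwd-rung-NavierStokesRegularity-01-0`, 2026-08-17.
Line card: `Cruxes/ForcedSymmetry/Lines/LedgerHigherIntegrability.md`; floor as the `p = 2` case:
`Cruxes/ForcedSymmetry/Lines/LedgerHigherIntegrability_special.lean`.

## The ladder (one parameter: the Morrey exponent `p`)

FLOOR (proved, `Theorems.FarPastLedger_proof`, p110296-family): for every Type-I constant `C` there is
`K` with `∫_{B_R(x₀)} |u(t)|² ≤ K·R` for every `u ∈ A_C` (= `IsTypeIAncientMild C u`), every `t < 0`,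
every centre and radius — the scale-invariant `L²`-Morrey ledger `M^{2,∞}` (Seregin's critical Morrey
quantity with `s = 2, l = ∞`; Albritton–Barker 2019 Lemma 2.6 / Remark 3.2).

`Ledger p C` := the same ledger at exponent `p`: `∫_{B_R(x₀)} |u(t)|^p ≤ K·R^{3-p}` (`M^{p,∞}` bounded on
`A_C`).  `LedgerRung p := ∀ C, Ledger p C`.  Floor = `LedgerRung 2` (`ledgerRung_two` below);
`LedgerRung 3` (uniform `L³` on every slice) gives X = `TypeIAncientLiouville` by the in-tree backward
`L³` Liouville (`lebL3B_liouville_rate`, Albritton–Barker Thm 1.2) — recorded in the card, not needed here.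

RUNG (this line's conclusion): `LedgerHigherIntegrability := ∀ C, ∃ p > 2, Ledger p C` — an
ε-improvement of the Morrey exponent.  Content sits entirely at super-parabolic radii `R ≫ √(-t)`
(for `R ≤ √(-t)` Type I gives it for every `p`): it says Type-I-saturated regions of an element of
`A_C` cannot fill tubes of super-parabolic length at LINEAR density — the quantitative, uniform-in-`A_C`
shadow of "Type-I singular sets are less than one-dimensional" (CKN give `𝒫¹ = 0`, no rate, no
uniformity).  DSS / `-1`-homogeneous tails `|u| ~ 1/|x|` satisfy it for every `p < 3` and violate
`p = 3`: the rung is strictly between floor and X in method, and implied by X (`rung_of_typeIAncientLiouville`).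

## Shape of the line (critical-element / rigidity split in the spatial translation group)

* `stub_filamentStructure` (HARDEST, speculative): failure of every `p > 2` ledger at level `C` forces
  elements of `A_C` carrying PERSISTENT FILAMENTS — solid tubes of radius `ρ`, arbitrarily large length
  `2Lρ`, on which `|u| ≥ λ/ρ` throughout a viscous time `ρ²` — with `λ = λ(C) > 0` independent of `L`.
* `stub_filamentCompactness` (standard, M–L): normalise `ρ = 1` by scaling, recentre, pass to the
  locally uniform limit in `A_C` (KNSS / Albritton–Barker compactness, tree `SuitableCompactness_holds`
  pattern): an element with an INFINITE persistent filament.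
* `stub_filamentLiouville` (rigidity, open but attackable; first provable sub-rung = the periodic-in-one-
  direction Liouville theorem for `A_C`, by blow-down to 2.5D + Giga–Matsui–Sawada / KNSS 2D): no element
  of any `A_C` carries an infinite persistent filament.
* `LedgerHigherIntegrability_of`: the rung, by contradiction, from the three stubs (sorries only in `stub_*`).

Obstructions honoured (`Cruxes/ForcedSymmetry/Disproof.lean`): `forcedSymmetry_false_without_H3/H3'`,
`not_forcedSymmetryOnDriftClass` — every statement here is over `IsTypeIAncientMild` (H1–H4, KNSS-mild
gauge); without H3 already the floor fails (`u = C e₁/√(-t)`).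
-/

set_option linter.dupNamespace false

namespace Summit.NavierStokesRegularity.NavierStokesRegularity.Cruxes.ForcedSymmetry.LedgerHigherIntegrability

open MeasureTheory Literature.Analysis.FluidPDE
open Summit.NavierStokesRegularity.NavierStokesRegularity.Theses.SymmetryModuliCount

local notation "E3" => EuclideanSpace ℝ (Fin 3)

/-! ## The ladder -/

/-- The scale-invariant `L^p`-Morrey ledger at exponent `p` on the Type-I ancient mild class `A_C`:
one constant `K` bounds `∫_{B_R(x₀)} |u(t,x)|^p dx ≤ K · R^{3-p}` for every element, slice, centre and
radius (Seregin's critical Morrey quantity `M^{p,∞}`; Albritton–Barker 2019 Lemma 2.6). -/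
def Ledger (p C : ℝ) : Prop :=
  ∃ K : ℝ, ∀ u : ℝ → E3 → E3, IsTypeIAncientMild C u →
    ∀ t < 0, ∀ (x₀ : E3) (R : ℝ), 0 < R →
      ∫ x in Metric.ball x₀ R, ‖u t x‖ ^ p ≤ K * R ^ (3 - p)

/-- Rung `p` of the ladder: the exponent-`p` ledger for every Type-I constant. Floor = `LedgerRung 2`. -/
def LedgerRung (p : ℝ) : Prop := ∀ C : ℝ, Ledger p C

/-- **THE RUNG** (`rung_decl`): higher integrability of the ledger — for every Type-I constant some
exponent `p > 2` of the scale-invariant Morrey ledger is bounded on `A_C`. -/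
def LedgerHigherIntegrability : Prop := ∀ C : ℝ, ∃ p : ℝ, 2 < p ∧ Ledger p C

/-! ## Filaments -/

/-- `u` carries, throughout the time window `[t₁, t₂]`, a filament of strength `lam` and radius `ρ` along
the segment `{a + s•e : |s| ≤ L}`: `|u(t', x)| ≥ lam/ρ` at every point within `ρ` of the segment. -/
def HasFilamentSeg (u : ℝ → E3 → E3) (t₁ t₂ lam ρ : ℝ) (a e : E3) (L : ℝ) : Prop :=
  ∀ t' ∈ Set.Icc t₁ t₂, ∀ s ∈ Set.Icc (-L) L, ∀ x : E3, dist x (a + s • e) ≤ ρ → lam / ρ ≤ ‖u t' x‖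

/-- The same along the whole line `{a + s•e : s ∈ ℝ}` (an infinite filament). -/
def HasFilament (u : ℝ → E3 → E3) (t₁ t₂ lam ρ : ℝ) (a e : E3) : Prop :=
  ∀ t' ∈ Set.Icc t₁ t₂, ∀ (s : ℝ) (x : E3), dist x (a + s • e) ≤ ρ → lam / ρ ≤ ‖u t' x‖

/-- S1 — FILAMENT LIOUVILLE (rigidity; open, attackable): no Type-I ancient mild field carries an
infinite filament persisting over a time window of positive length. -/
def FilamentLiouville : Prop :=
  ∀ (C : ℝ) (u : ℝ → E3 → E3), IsTypeIAncientMild C u →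
    ∀ t₁ t₂ : ℝ, t₁ < t₂ → t₂ < 0 → ∀ lam ρ : ℝ, 0 < lam → 0 < ρ →
      ∀ a e : E3, e ≠ 0 → ¬ HasFilament u t₁ t₂ lam ρ a e

/-- S2 — FILAMENT STRUCTURE (hardest, speculative): if no exponent `p > 2` of the ledger is bounded on
`A_C`, then `A_C` contains elements with persistent filaments (window = one viscous time `ρ²`) of a
fixed strength `lam = lam(C) > 0` and arbitrarily large half-length `L` (in units of `ρ`, `‖e‖ = 1`). -/
def FilamentStructure : Prop :=
  ∀ C : ℝ, (¬ ∃ p : ℝ, 2 < p ∧ Ledger p C) →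
    ∃ lam : ℝ, 0 < lam ∧ ∀ L : ℝ, ∃ u : ℝ → E3 → E3, IsTypeIAncientMild C u ∧
      ∃ t ρ : ℝ, t < 0 ∧ 0 < ρ ∧ ∃ a e : E3, ‖e‖ = 1 ∧
        HasFilamentSeg u (t - ρ ^ 2) t lam ρ a e (L * ρ)

/-- S3 — FILAMENT COMPACTNESS (standard): arbitrarily long persistent filaments of fixed strength in
`A_C` yield, after rescaling `ρ = 1`, recentring and a locally uniform limit inside `A_C`, an element
with an infinite filament persisting over a window of positive length. -/
def FilamentCompactness : Prop :=
  ∀ C lam : ℝ, 0 < lam →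
    (∀ L : ℝ, ∃ u : ℝ → E3 → E3, IsTypeIAncientMild C u ∧
      ∃ t ρ : ℝ, t < 0 ∧ 0 < ρ ∧ ∃ a e : E3, ‖e‖ = 1 ∧
        HasFilamentSeg u (t - ρ ^ 2) t lam ρ a e (L * ρ)) →
    ∃ u : ℝ → E3 → E3, IsTypeIAncientMild C u ∧
      ∃ t₁ t₂ : ℝ, t₁ < t₂ ∧ t₂ < 0 ∧ ∃ ρ : ℝ, 0 < ρ ∧ ∃ a e : E3, e ≠ 0 ∧
        HasFilament u t₁ t₂ lam ρ a e

/-! ## Registered stubs -/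

/-- stub S1 `FilamentLiouville` (rigidity; L–XL). First provable sub-rung: the periodic-in-one-direction
case (blow-down of `A_C` is asymptotically 2.5D; Giga–Matsui–Sawada 2D `L^∞` theory + `L^∞`-mild
stability); nearest print: Lei–Ren–Zhang, Math. Ann. 2021 (axisymmetric, periodic in `x₃`). -/
theorem stub_filamentLiouville : FilamentLiouville := by
  sorry

/-- stub S2 `FilamentStructure` (HARDEST; speculative structure theorem: large `L^p`-Morrey ratio at
super-parabolic scale in an NS Type-I ancient element ⇒ a long persistent filament). -/
theorem stub_filamentStructure : FilamentStructure := by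
  sorry

/-- stub S3 `FilamentCompactness` (M–L; scaling/translation invariance of `A_C` + KNSS/AB compactness). -/
theorem stub_filamentCompactness : FilamentCompactness := by
  sorry

/-! ## Composition -/

/-- Statement-level composition: S1 → S2 → S3 → RUNG (by contradiction: S2 and S3 build the critical
element, S1 kills it). -/
theorem composition (h1 : FilamentLiouville) (h2 : FilamentStructure) (h3 : FilamentCompactness) :
    LedgerHigherIntegrability := by
  intro C
  by_contra hC
  obtain ⟨lam, hlam, hL⟩ := h2 C hC
  obtain ⟨u, hu, t₁, t₂, h12, h2neg, ρ, hρ, a, e, he, hF⟩ := h3 C lam hlam hL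
  exact h1 C u hu t₁ t₂ h12 h2neg lam ρ hlam hρ a e he hF

/-- THE SKELETON: the rung `LedgerHigherIntegrability` by name, from the three registered stubs
(sorries only inside `stub_*`). -/
theorem LedgerHigherIntegrability_of : LedgerHigherIntegrability :=
  composition stub_filamentLiouville stub_filamentStructure stub_filamentCompactness

/-! ## Context (no sorry): floor = rung 2, X ⇒ rung (on-path), and the residual above the rung -/

/-- The rung family at `p = 2` IS the floor `FarPastLedger` (stmt-14060), literally
(up to `x ^ (2:ℝ) = x ^ 2`, `R ^ (1:ℝ) = R`). -/
theorem ledgerRung_two_iff_floor : LedgerRung 2 ↔ FarPastLedger := by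
  have e3 : (3 : ℝ) - 2 = 1 := by norm_num
  simp only [LedgerRung, Ledger, FarPastLedger, Real.rpow_two, e3, Real.rpow_one]

/-- FLOOR = RUNG 2, from the landed floor theorem `Theorems.FarPastLedger_proof`. -/
theorem ledgerRung_two : LedgerRung 2 :=
  ledgerRung_two_iff_floor.mpr Summit.NavierStokesRegularity.NavierStokesRegularity.Theorems.FarPastLedger_proof

/-- ON-PATH: X = `TypeIAncientLiouville` gives every rung (all elements vanish), in particular the rung. -/
theorem ledgerRung_of_typeIAncientLiouville (hX : TypeIAncientLiouville) (p : ℝ) (hp : 0 < p) :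
    LedgerRung p := by
  intro C
  refine ⟨0, fun u hu t ht x₀ R hR => ?_⟩
  have h0 : ∀ x, u t x = 0 := fun x => hX C u (isTypeIAncientMild_iff.mp hu) t ht x
  have : (fun x => ‖u t x‖ ^ p) = fun _ => (0 : ℝ) := by
    funext x
    rw [h0 x, norm_zero, Real.zero_rpow hp.ne']
  rw [this]
  simp

theorem rung_of_typeIAncientLiouville (hX : TypeIAncientLiouville) : LedgerHigherIntegrability :=
  fun C => ⟨5 / 2, by norm_num, ledgerRung_of_typeIAncientLiouville hX (5 / 2) (by norm_num) C⟩

/-- ON-PATH through the crux: `ForcedSymmetry` (⇔ X in the tree) gives the rung. -/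
theorem rung_of_forcedSymmetry (h : ForcedSymmetry) : LedgerHigherIntegrability :=
  rung_of_typeIAncientLiouville
    (Summit.NavierStokesRegularity.NavierStokesRegularity.Theorems.SymmetryModuliCountForcedSymmetry.forcedSymmetry_iff_typeIAncientLiouville.mp h)

/-- The declared RESIDUAL above the rung (`gap_after` of the card; NOT a stub, NOT claimed): from some
`p > 2` to X.  With it the rung reaches the crux by name. -/
def ResidualAboveRung : Prop := LedgerHigherIntegrability → TypeIAncientLiouville

/-- Navigation only: rung + declared residual ⇒ the crux `ForcedSymmetry` by name
(`Theorems.forcedSymmetry_of_typeIAncientLiouville`). -/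
theorem forcedSymmetry_of_rung_and_residual (h : LedgerHigherIntegrability) (hres : ResidualAboveRung) :
    ForcedSymmetry :=
  Summit.NavierStokesRegularity.NavierStokesRegularity.Theorems.forcedSymmetry_of_typeIAncientLiouville (hres h)

end Summit.NavierStokesRegularity.NavierStokesRegularity.Cruxes.ForcedSymmetry.LedgerHigherIntegrability
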